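import Summits.HodgeConjecture.HodgeConjecture.Theorems.Ring2AbelianAllAndreTransportLatticeCM
import Summits.HodgeConjecture.HodgeConjecture.Theorems.Ring2AbelianAllAndreGraded
import Summits.HodgeConjecture.HodgeConjecture.Theorems.Ring2ClassTargetsRows
import HarnessLib

/-!
# Ring 2 · sub-cell AbelianAll (ALL ABELIAN VARIETIES), André axis, part XIX-a — SPREADING: granted the classical
# Hilbert-scheme spreading of fibrewise algebraic classes over a curve (Voisin II §3.3.1 / proof of Thm. 10.19;
# Charles–Schnell, proof of Prop. 11.3.11), TRANSPORT = LIFT on compact pencils of abelian varieties: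
# **(2) ⟺ (L∀)**, **(4) ⟺ (L)**, **(3) ⟺ (L∀) on CM-pointed pencils**, `HC_AV ⟹ (L∀)`, and the EXACTNESS of the
# cycle-theoretic nodes: **`HC_AV ⟺ HC_CM ∧ (L) ⟺ HC_CM ∧ (L∀)`** (mod Lemme 6.3.1); graded: **`HC` in dimension
# `d` alone gives the algebraic fixed part on every compact pencil of relative dimension `d`** (so `d = 4, 5`
# modulo Moonen–Zarhin 1999 and Markman 2025)

HONEST FRAMING (page 1, verbatim): **research route, not a corollary; conditional on HC_CM plus one named
minimal statement.** Cell line: research route conditional on HC_CM; not a corollary; Q11.4-sentence-2 already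
refuted in dim ≥ 3. Nothing in this file proves a case of the Hodge conjecture for an abelian variety. `HC_CM`
(`Theses.RankFourFaces.CMAbelianHodge`) and `HC_AV` (`Theses.PadicSemiregularLift.HodgeAbelianVarieties`) are
BINDERS wherever they occur; the reduction item `CMToAbelian` (stmt-HodgeConjecture-16267) is NOT closed here.

## What this part does (RING2-MAP §AbelianAll, owed item o8 since gen 2; part VI §F: "in print it exists: all fibre
## classes are algebraic by transport, and the relative Hilbert scheme spreads them")

Parts I–XVIII left the André axis with TWO kinds of node: TRANSPORT nodes ((2) `CompactAbelianPencilVHC`,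
(3) `CMPointedPencilVHC`, (4) `CMAnchoredTransport`: algebraicity of an invariant class moves from fibre to fibre)
and LIFT nodes ((L) `CMFibreAlgebraicLift`, (L∀) `AlgebraicFixedPart`: an invariant class algebraic on a fibre IS
the restriction of an algebraic class of the `(d+1)`-dimensional total space), with the kernel edges
(L∀) ⟹ (L) ⟹ (4), (L∀) ⟹ (2) ⟹ (3) ⟹ (4) and the converses (2) ⟹ (L∀), (4) ⟹ (L) OPEN ("lift at one point",
part XVII-e). The missing converse is classical in print: if a class is algebraic on EVERY fibre of a smooth
projective family over a curve, the relative Hilbert scheme has a component dominating the base along which the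
cycles move, and the push-forward of the universal cycle over a multisection, divided by its degree, is a cycle
on the total space with the right restrictions (Voisin II §3.3.1 and the device of the proof of Thm. 10.19;
Charles–Schnell, proof of Prop. 11.3.11; Arapura 2022, proof of Cor. 1.5). The tree names this for `X → ℙ¹`
(`HodgeTheory.spread_algebraicClasses_over_projectiveLine`, with a `TODO(general form)` for curve bases) and,
for supports only, over smooth curves (`HodgeTheory.spread_supports_over_smoothCurve`, proved modulo Verdier's
generic local triviality). This part CONSUMES the class form over a smooth curve as the explicit HYPOTHESIS SHAPE
`SpreadCurve[]` (local notation; its body is VERBATIM the statement filed by this seat as the Literature named fact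
`HodgeTheory.spread_algebraicClasses_over_smoothCurve` — until that fact is importable every row carries
`hSp : SpreadCurve[]` explicitly, exactly as part II carried `Milne2020Prop1[]`; nothing is vendored: no `def`).

* §0 carrier: a proper Zariski-closed subset of the base misses a complex point (Jacobson).
* §1 THE ENGINE `exists_algebraic_lift_of_forall_mem_algebraicClasses`: on a compact pencil of abelian varieties,
  a global class with rational fibre restrictions which is algebraic on EVERY fibre agrees on EVERY fibre with ONE
  algebraic class of the total space (codimension `0`: `N⁰ = ⊤`; codimension `> d`: the fibre cohomology is `0`;
  `1 ≤ p ≤ d`: rational global representative (part XVII-a) + `SpreadCurve[]` + a complex point off the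
  exceptional closed set + flatness of fibre restrictions (part I's engine)).
* §2 **(2) ⟺ (L∀)** and **(4) ⟺ (L)** granted `SpreadCurve[]` — NO `HC_CM`, no other input; **(3) ⟺ [(L∀) on
  CM-pointed pencils]** (with part XVII-e); under `HC_CM` and Lemme 6.3.1 ALL FIVE nodes coincide.
* §3 ON-PATH and EXACTNESS: `HC_AV ⟹ (L∀)`, `HC_AV ⟹ (L)` (parts VI needed the Hodge conjecture for the TOTAL
  SPACE); **`HC_AV ⟺ HC_CM ∧ (L)`**, **`HC_AV ⟺ HC_CM ∧ (L∀)`**, `CMToAbelian ⟺ (HC_CM → (L))` (mod `h₂₁`,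
  `SpreadCurve[]`). With part XVIII-c (`HC_CM ⊢ (L) ⟺ Num^CM`) the numerical node Num^CM is therefore EXACT too
  (`HC_AV ⟺ HC_CM ∧ Num^CM`, part XIX-b, filed when part XVIII-c is importable on the farm).
* §4 GRADED: `HCAtDim d ∧ SpreadCurve[] ⟹` the body of (L∀) on every compact pencil of relative dimension `d` — the
  LIFT needs no cycle on the total space beyond what the Hilbert scheme produces from the fibres. Hence the
  algebraic fixed part for pencils of abelian FOURFOLDS and FIVEFOLDS modulo the tree's named facts
  `MoonenZarhin1999_codimTwoHodgeClasses_abelianFourfold/Fivefold` and `Markman2025_weilClasses_algebraic_abelianFourfold`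
  (through `ClassTargets.hcAtDim_four_of_weilClassesFourfolds`, `hcAtDim_five_of_hcAtDim_four`). HONEST
  ACCOUNTING: part XVIII-i's "smallest open instance of the LIFT, `d = 4`, `(p,q) = (2,2)`" is open in the KERNEL
  only modulo [spreading (classical, printed) + Moonen–Zarhin 1999 (printed) + Markman 2025 (arXiv claim)]; the
  first relative dimension where the lift is open in print as well is `d = 6` (Weil-type sixfold fibres: the
  W₆ habitat of parts IX/X-e/XV), where `HC` of the non-CM fibres is the open Weil-class question itself.

EDGE LABELS for RING2-MAP: every theorem K[SpreadCurve] (kernel modulo the one classical spreading statement,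
carried as a hypothesis); §0 unconditional. No `def`, no `sorry`, no new node; axioms standard.

References: VoisinHodgeII2003 (§3.3.1; §10.2.1 proof of Thm. 10.19; §3.1.2); CharlesSchnell2014Notes
(Prop. 11.3.5, Cor. 11.3.6, Prop. 11.3.11); Arapura2022 (Cor. 1.5); Kollar1996 (Thm. I.1.4); Fulton1998 (§10.1,
Prop. 10.3, Cor. 19.2); Andre1996Motifs (§5.1 (A3)–(A4) p. 25, Lemme 6.3.1 p. 31, §6.3 a) and Remarque 2 p. 33);
Milne2020HodgeClassesAV (Prop. 1, last line of the proof, p. 8); Abdulali1994FamiliesAV ((1.1) p. 1122, Lemma 6.2);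
MoonenZarhin1999LowDim (Thms. 0.1–0.2); Markman2025SecantWeil (Cor. 1.6.1); GortzWedhorn2020 (Prop. 3.35).
-/

noncomputable section

set_option linter.dupNamespace false

namespace Summit.HodgeConjecture.HodgeConjecture.Ring2.AbelianAll

open CategoryTheory AlgebraicGeometry
open Literature.AlgebraicGeometry Literature.AlgebraicGeometry.Motives
open Literature.AlgebraicGeometry.HodgeTheory
open Literature.AlgebraicGeometry.Abdulali1994 (InvariantCyclesHoldFor)
open Literature.AlgebraicGeometry.Andre1996 (andre1996_cmAnchoredPencil)
open Literature.AlgebraicGeometry.Deligne1982 (cmLocus)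
open Summit.HodgeConjecture.HodgeConjecture
open Summit.HodgeConjecture.HodgeConjecture.Theses
open Summit.HodgeConjecture.HodgeConjecture.Ring2.Deform (CompactAbelianPencilVHC compactAbelianPencilVHC_of_HC_AV
  HC_CM_of_HC_AV)
open Summit.HodgeConjecture.HodgeConjecture.Ring2.ClassTargets (HCAtDim hcAtDim_four_of_weilClassesFourfolds
  hcAtDim_five_of_hcAtDim_four)

variable {𝒳 S : SchemeOver ℂ}

/-- `SpreadCurve[]` — the HYPOTHESIS SHAPE in which this part consumes the classical spreading of fibrewise
algebraic classes over a smooth curve (Voisin II §3.3.1 with the device of the proof of Thm. 10.19;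
Charles–Schnell, proof of Prop. 11.3.11): for `f : W ⟶ T` flat and proper from a quasi-projective `W` onto a
smooth irreducible curve `T`, fibres off a proper closed `S` smooth projective `d`-folds, `1 ≤ q ≤ d`, and a
RATIONAL class `c ∈ H^{2q}(W(ℂ); ℂ)` algebraic on every good fibre, there is an algebraic rational class `a` of
`W` with `(c - a)|_{W_t} = 0` off a larger proper closed `S'`. The body is VERBATIM the statement of the
Literature named fact `HodgeTheory.spread_algebraicClasses_over_smoothCurve` filed by this seat (so every row
instantiates by `exact h` once it is importable); it generalises the tree's `spread_algebraicClasses_over_projectiveLine`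
(base `ℙ¹`). NOT vendored: no definition is made here. [cite: VoisinHodgeII2003, §3.3.1 and §10.2.1, proof of Thm. 10.19]
[cite: CharlesSchnell2014Notes, Prop. 11.3.11 (proof)] [cite: Arapura2022, Cor. 1.5 (proof)] -/
local notation3 (prettyPrint := false) "SpreadCurve[]" =>
  ∀ ⦃d q : ℕ⦄ ⦃T W : SchemeOver ℂ⦄ (f : W ⟶ T),
    SmoothOfRelativeDimension 1 T.hom → IrreducibleSpace T.left → IsQuasiProjectiveOver W →
    Flat f.left → IsProper f.left → 1 ≤ q → q ≤ d →
    ∀ S : Set T.left, IsClosed S → S ≠ Set.univ →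
      (∀ t : ComplexPoints T, t.pt ∉ S → IsSmoothProjective d (fiberOver f t)) →
      ∀ c : complexBetti W (2 * q), IsRationalClass c →
        (∀ t : ComplexPoints T, t.pt ∉ S →
          complexBetti.map (fiberι f t) (2 * q) c ∈ algebraicClasses (fiberOver f t) q) →
        ∃ a : complexBetti W (2 * q), a ∈ algebraicClasses W q ∧ IsRationalClass a ∧
          ∃ S' : Set T.left, IsClosed S' ∧ S ⊆ S' ∧ S' ≠ Set.univ ∧
            ∀ t : ComplexPoints T, t.pt ∉ S' →
              complexBetti.map (fiberι f t) (2 * q) (c - a) = 0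

/-! ## §0 Carrier: a proper Zariski-closed subset of the base misses a complex point -/

/-- **"Choose `t` off `S'`"**: a proper Zariski-closed subset of a `ℂ`-scheme locally of finite type misses the
point of some complex point — its open complement is non-empty, hence contains a closed point (`ℂ`-schemes locally
of finite type are Jacobson), i.e. the point of a complex point (Nullstellensatz, the tree's
`ComplexPoints.equivClosedPoints`). [cite: GortzWedhorn2020, Prop. 3.35] -/
theorem exists_complexPoint_off_closed {Y : SchemeOver ℂ} [LocallyOfFiniteType Y.hom]
    {T : Set Y.left} (hT : IsClosed T) (hTne : T ≠ Set.univ) :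
    ∃ P : ComplexPoints Y, P.pt ∉ T := by
  haveI : JacobsonSpace ↥Y.left := ComplexPoints.jacobsonSpace_left
  obtain ⟨x, hxT, hxc⟩ := nonempty_inter_closedPoints (X := ↥Y.left) (Set.nonempty_compl.mpr hTne)
    hT.isOpen_compl.isLocallyClosed
  exact ⟨(ComplexPoints.equivClosedPoints Y).symm ⟨x, hxc⟩,
    by rwa [ComplexPoints.pt_equivClosedPoints_symm_apply]⟩

/-! ## §1 The engine: fibrewise algebraic ⟹ ONE algebraic class of the total space with the same restrictions -/

/-- **THE ENGINE (Grothendieck's algebraic "partie fixe" from fibrewise algebraicity).** On a compact pencil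
`f : 𝒳 ⟶ S` of abelian `d`-folds, let `W ∈ H²ᵖ(𝒳(ℂ); ℂ)` have RATIONAL fibre restrictions which are ALGEBRAIC
on every fibre. Then, granted `SpreadCurve[]`, some ALGEBRAIC class `η ∈ Nᵖ H²ᵖ(𝒳(ℂ); ℂ)` of the
`(d+1)`-dimensional total space has `η|_{𝒳_s} = W|_{𝒳_s}` for EVERY `s`. Proof: `p = 0` — `N⁰(𝒳) = ⊤`
(`algebraicClasses_zero`), `η := W`; `p > d` — `H²ᵖ(𝒳_s) = 0` (`subsingleton_complexBetti`), `η := 0`;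
`1 ≤ p ≤ d` — replace `W` by a RATIONAL global class `W₀` with the same restrictions (part XVII-a,
`exists_isRationalClass_map_fiberι_eq`), apply the spreading to the smooth projective family `f` (flat: smooth;
proper; `𝒳` projective hence quasi-projective; base a smooth irreducible curve; no bad fibres, `S := ∅`) to get an
algebraic `a` with `(W₀ - a)|_{𝒳_t} = 0` off a proper closed `S'`, pick a complex point `t₁` off `S'` (§0), and
propagate `(W₀ - a)|_{𝒳_{t₁}} = 0` to every fibre by flatness of fibre restrictions (part X-c's
`map_fiberι_eq_zero_of_eq_zero`, André's input (A4)). [cite: VoisinHodgeII2003, §3.3.1 and §10.2.1, proof of Thm. 10.19]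
[cite: CharlesSchnell2014Notes, Prop. 11.3.11 (proof) and Prop. 11.3.5] [cite: Andre1996Motifs, §5.1 (A3)–(A4) (p. 25)] -/
theorem exists_algebraic_lift_of_forall_mem_algebraicClasses (hSp : SpreadCurve[]) {d : ℕ} {f : 𝒳 ⟶ S}
    (hf : IsCompactAbelianPencil f d) {p : ℕ} (W : complexBetti 𝒳 (2 * p))
    (hrat : ∀ s : ComplexPoints S, IsRationalClass (complexBetti.map (fiberι f s) (2 * p) W))
    (halg : ∀ s : ComplexPoints S, complexBetti.map (fiberι f s) (2 * p) W ∈ algebraicClasses (fiberOver f s) p) :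
    ∃ η ∈ algebraicClasses 𝒳 p, ∀ s : ComplexPoints S,
      complexBetti.map (fiberι f s) (2 * p) η = complexBetti.map (fiberι f s) (2 * p) W := by
  rcases Nat.eq_zero_or_pos p with rfl | hp
  · exact ⟨W, by rw [algebraicClasses_zero]; exact Submodule.mem_top, fun s ↦ rfl⟩
  rcases le_or_gt p d with hpd | hdp
  swap
  · refine ⟨0, Submodule.zero_mem _, fun s ↦ ?_⟩
    haveI := subsingleton_complexBetti (hf.isSmoothProjective_fiberOver s) (show 2 * d < 2 * p by omega)
    exact Subsingleton.elim _ _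
  rcases isEmpty_or_nonempty (ComplexPoints S) with hS | ⟨⟨s₁⟩⟩
  · exact ⟨0, Submodule.zero_mem _, fun s ↦ (IsEmpty.false s).elim⟩
  -- a rational global representative of the (flat) family of fibre restrictions
  obtain ⟨W₀, hW₀, hW₀W⟩ := exists_isRationalClass_map_fiberι_eq hf W (hrat s₁)
  -- the hypotheses of the spreading statement for the smooth projective family `f`
  haveI hSsm : SmoothOfRelativeDimension 1 S.hom := hf.isSmoothProjective_base.smoothOfRelativeDimension
  haveI hSirr : IrreducibleSpace S.left := Andre1996.compactPencil_irreducibleSpace_base hf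
  have h𝒳qp : IsQuasiProjectiveOver 𝒳 :=
    IsQuasiProjectiveOver.of_isProjectiveOver hf.isSmoothProjective_total.isProjectiveOver
  haveI hfsm : AlgebraicGeometry.Smooth f.left := hf.isSmoothProjectiveFamily.smooth
  have hflat : Flat f.left := inferInstance
  have hprop : IsProper f.left := hf.isSmoothProjectiveFamily.isProper
  have huniv : (∅ : Set S.left) ≠ Set.univ := by
    intro h
    have hmem : s₁.pt ∈ (∅ : Set S.left) := by rw [h]; exact Set.mem_univ _
    exact hmem
  obtain ⟨a, ha, -, S', hS', -, hS'ne, hvan⟩ := hSp f hSsm hSirr h𝒳qp hflat hprop hp hpd ∅ isClosed_empty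
    huniv (fun t _ ↦ hf.isSmoothProjective_fiberOver t) W₀ hW₀
    (fun t _ ↦ by rw [hW₀W t]; exact halg t)
  -- a complex point off the exceptional closed set, then flat propagation to every fibre
  haveI : AlgebraicGeometry.Smooth S.hom := Andre1996.compactPencil_smooth_base hf
  haveI : LocallyOfFiniteType S.hom := inferInstance
  obtain ⟨t₁, ht₁⟩ := exists_complexPoint_off_closed hS' hS'ne
  have h0 : complexBetti.map (fiberι f t₁) (2 * p) (W₀ - a) = 0 := hvan t₁ ht₁
  refine ⟨a, ha, fun s ↦ ?_⟩
  have hs := map_fiberι_eq_zero_of_eq_zero hf h0 s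
  rw [map_sub, sub_eq_zero, hW₀W s] at hs
  exact hs.symm

/-- **The engine under `HC` for the fibres**: if the Hodge conjecture holds for complex abelian varieties of
dimension `d` (`ClassTargets.HCAtDim d`), then on every compact pencil of abelian `d`-folds every global class
with rational `(p,p)` fibre restrictions is algebraic on every fibre (each fibre is `≅ A'.X` with `dim A' = d`,
`Andre1996.compactPencil_exists_abelianVariety_fiber_dim`; move the class along the chart, as in part IV's
`invariantCyclesHoldFor_compactPencil_of_hcAtDim`), hence — granted `SpreadCurve[]` — agrees on every fibre with
ONE algebraic class of the total space. [cite: CharlesSchnell2014Notes, Prop. 11.3.5 and Cor. 11.3.6 (p. 494)]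
[cite: VoisinHodgeII2003, §3.3.1] -/
theorem exists_algebraic_lift_of_hcAtDim (hSp : SpreadCurve[]) {d : ℕ} (h : HCAtDim d) {f : 𝒳 ⟶ S}
    (hf : IsCompactAbelianPencil f d) {p : ℕ} (W : complexBetti 𝒳 (2 * p))
    (hW : ∀ s : ComplexPoints S, IsRationalClass (complexBetti.map (fiberι f s) (2 * p) W) ∧
      IsOfHodgeType d (fiberOver f s) (2 * p) p p (complexBetti.map (fiberι f s) (2 * p) W)) :
    ∃ η ∈ algebraicClasses 𝒳 p, ∀ s : ComplexPoints S,
      complexBetti.map (fiberι f s) (2 * p) η = complexBetti.map (fiberι f s) (2 * p) W := by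
  refine exists_algebraic_lift_of_forall_mem_algebraicClasses hSp hf W (fun s ↦ (hW s).1) fun s ↦ ?_
  obtain ⟨B, hBdim, ⟨eB⟩⟩ := Andre1996.compactPencil_exists_abelianVariety_fiber_dim hf s
  have hB : IsSmoothProjective B.dim B.X := AbelianVariety.isSmoothProjective_holds
  have hHCB := ((hodgeConjectureFor_iff_of_isSmoothProjective nonempty_hodgeModel_holds hB).1 (h B hBdim)) p
  rw [hBdim] at hHCB
  exact (forall_hodgeClass_mem_algebraicClasses_iff_of_iso eB p).1 hHCB _ (hW s).1 (hW s).2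

/-! ## §2 Transport = lift, granted spreading -/

/-- **(2) ⟹ (L∀), granted `SpreadCurve[]`** (RING2-MAP owed item o8; converse of part I's
`compactAbelianPencilVHC_of_algebraicFixedPart`): transport makes the invariant class algebraic on EVERY fibre,
and the engine of §1 lifts it. [cite: Milne2020HodgeClassesAV, Prop. 1, last line of the proof (p. 8)]
[cite: VoisinHodgeII2003, §3.3.1 and §10.2.1, proof of Thm. 10.19] -/
theorem algebraicFixedPart_of_compactAbelianPencilVHC (hSp : SpreadCurve[]) (h₂ : CompactAbelianPencilVHC) :
    AlgebraicFixedPart := by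
  intro d 𝒳 S f hf p W hW s₀ h₀
  obtain ⟨η, hη, hηW⟩ := exists_algebraic_lift_of_forall_mem_algebraicClasses hSp hf W (fun s ↦ (hW s).1)
    (h₂ f hf p W hW ⟨s₀, h₀⟩)
  exact ⟨η, hη, hηW s₀⟩

/-- **(2) ⟺ (L∀), granted `SpreadCurve[]`**: variational Hodge on compact pencils of abelian varieties IS the
algebraic fixed part. No `HC_CM`, no other input. [cite: Milne2020HodgeClassesAV, Prop. 1 (p. 7)]
[cite: CharlesSchnell2014Notes, Prop. 11.3.11 (proof)] -/
theorem algebraicFixedPart_iff_compactAbelianPencilVHC (hSp : SpreadCurve[]) :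
    AlgebraicFixedPart ↔ CompactAbelianPencilVHC :=
  ⟨compactAbelianPencilVHC_of_algebraicFixedPart, algebraicFixedPart_of_compactAbelianPencilVHC hSp⟩

/-- **(4) ⟹ (L), granted `SpreadCurve[]`** (converse of part I's `cmAnchoredTransport_of_cmFibreAlgebraicLift`):
transport out of the CM fibre makes the class algebraic on every fibre; the engine lifts it; read the lift at the
CM fibre. [cite: Andre1996Motifs, §5.1 (A3) (p. 25) and §6.3 a) (p. 33)] [cite: VoisinHodgeII2003, §3.3.1] -/
theorem cmFibreAlgebraicLift_of_cmAnchoredTransport (hSp : SpreadCurve[]) (h₄ : CMAnchoredTransport) :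
    CMFibreAlgebraicLift := by
  intro d 𝒳 S f hf p W hW t ht h₀
  obtain ⟨η, hη, hηW⟩ := exists_algebraic_lift_of_forall_mem_algebraicClasses hSp hf W (fun s ↦ (hW s).1)
    (h₄ f hf p W hW t ht h₀)
  exact ⟨η, hη, hηW t⟩

/-- **(4) ⟺ (L), granted `SpreadCurve[]`**: CM-anchored transport IS the cycle-theoretic lift at CM fibres — the
`B_min` of part I and the "find the cycle on `𝒳`" node are ONE statement modulo the classical spreading lemma.
No `HC_CM`. [cite: Andre1996Motifs, §6.3 a) (p. 33)] [cite: CharlesSchnell2014Notes, Prop. 11.3.11 (proof)] -/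
theorem cmFibreAlgebraicLift_iff_cmAnchoredTransport (hSp : SpreadCurve[]) :
    CMFibreAlgebraicLift ↔ CMAnchoredTransport :=
  ⟨cmAnchoredTransport_of_cmFibreAlgebraicLift, cmFibreAlgebraicLift_of_cmAnchoredTransport hSp⟩

/-- **(3) ⟹ (L), granted `SpreadCurve[]`** ((3) ⟹ (4) ⟹ (L)). [cite: Andre1996Motifs, §6.3 a) (p. 33)] -/
theorem cmFibreAlgebraicLift_of_cmPointedPencilVHC (hSp : SpreadCurve[]) (h₃ : CMPointedPencilVHC) :
    CMFibreAlgebraicLift :=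
  cmFibreAlgebraicLift_of_cmAnchoredTransport hSp (cmAnchoredTransport_of_cmPointedPencilVHC h₃)

/-- **(3) ⟺ [(L∀) on CM-pointed pencils], granted `SpreadCurve[]`** — part XVII-e's
`algebraicFixedPart_cmPointed_iff` ((L∀)_CM ⟺ (3) ∧ (L), in the lattice form
`(j_s^*)⁻¹N^p(𝒳_s) = N^p(𝒳) ⊔ ker j_s^*` at every fibre of every CM-pointed compact pencil) with the conjunct (L)
now supplied by (3). [cite: Milne2020HodgeClassesAV, Prop. 1 (p. 7)] [cite: Andre1996Motifs, §6.3 (p. 33)] -/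
theorem cmPointed_algebraicFixedPart_iff_cmPointedPencilVHC (hSp : SpreadCurve[]) :
    (∀ ⦃d : ℕ⦄ ⦃𝒳 S : SchemeOver ℂ⦄ (f : 𝒳 ⟶ S) (hf : IsCompactAbelianPencil f d), (cmLocus f d).Nonempty →
      ∀ (p : ℕ) (s : ComplexPoints S),
        (algebraicClasses (fiberOver f s) p).comap (complexBetti.map (fiberι f s) (2 * p)).hom =
          algebraicClasses 𝒳 p ⊔ LinearMap.ker (complexBetti.map (fiberι f s) (2 * p)).hom) ↔
      CMPointedPencilVHC := by
  rw [algebraicFixedPart_cmPointed_iff]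
  exact ⟨fun h ↦ h.1, fun h ↦ ⟨h, cmFibreAlgebraicLift_of_cmPointedPencilVHC hSp h⟩⟩

/-- **The ladder collapses to (L∀) ⟺ (2) ⟹ (3) ⟹ (4) ⟺ (L), granted `SpreadCurve[]`** (the two remaining
one-way edges, (3) ⟹ (2) and (4) ⟹ (3), are transport INTO non-anchored / CM fibres and stay OPEN without
`HC_CM`). [cite: Andre1996Motifs, §6.3 Remarque 2 (p. 33)] -/
theorem liftLadder_of_spread (hSp : SpreadCurve[]) :
    (AlgebraicFixedPart ↔ CompactAbelianPencilVHC) ∧ (CompactAbelianPencilVHC → CMPointedPencilVHC) ∧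
      (CMPointedPencilVHC → CMAnchoredTransport) ∧ (CMAnchoredTransport ↔ CMFibreAlgebraicLift) :=
  ⟨algebraicFixedPart_iff_compactAbelianPencilVHC hSp, cmPointedPencilVHC_of_compactAbelianPencilVHC,
    cmAnchoredTransport_of_cmPointedPencilVHC, (cmFibreAlgebraicLift_iff_cmAnchoredTransport hSp).symm⟩

/-! ## §3 On-path with `HC_AV` only, and EXACTNESS of the lift nodes -/

/-- **ON-PATH: `HC_AV ⟹ (L∀)`, granted `SpreadCurve[]`** (part VI's `algebraicFixedPart_of_hodgeConjecture` needed
the Hodge conjecture for the TOTAL SPACES; here HC for the abelian FIBRES suffices: Charles–Schnell Cor. 11.3.6 on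
each fibre, then the engine). [cite: CharlesSchnell2014Notes, Cor. 11.3.6 (p. 494)] [cite: VoisinHodgeII2003, §3.3.1] -/
theorem algebraicFixedPart_of_HC_AV (hSp : SpreadCurve[]) (h : PadicSemiregularLift.HodgeAbelianVarieties) :
    AlgebraicFixedPart :=
  algebraicFixedPart_of_compactAbelianPencilVHC hSp (compactAbelianPencilVHC_of_HC_AV h)

/-- **ON-PATH: `HC_AV ⟹ (L)`, granted `SpreadCurve[]`.** [cite: CharlesSchnell2014Notes, Cor. 11.3.6 (p. 494)] -/
theorem cmFibreAlgebraicLift_of_HC_AV (hSp : SpreadCurve[]) (h : PadicSemiregularLift.HodgeAbelianVarieties) :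
    CMFibreAlgebraicLift :=
  cmFibreAlgebraicLift_of_cmAnchoredTransport hSp (cmAnchoredTransport_of_HC_AV h)

/-- **EXACTNESS of (L): granted Lemme 6.3.1 and `SpreadCurve[]`, `HC_AV ⟺ HC_CM ∧ CMFibreAlgebraicLift`** — the
cycle-theoretic lift at CM fibres is necessary (§3 on-path) and, with `HC_CM`, sufficient (part I). So the
"find the cycle on the `(d+1)`-fold" form of `B_min` loses nothing against the transport form (4). `HC_CM` and
`h₂₁` are BINDERS. research route, not a corollary; conditional on HC_CM plus one named minimal statement.
[cite: Andre1996Motifs, Lemme 6.3.1 (p. 31) and Remarque 2 (p. 33)] [cite: CharlesSchnell2014Notes, Cor. 11.3.6] -/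
theorem HC_AV_iff_HC_CM_and_cmFibreAlgebraicLift (h₂₁ : andre1996_cmAnchoredPencil) (hSp : SpreadCurve[]) :
    PadicSemiregularLift.HodgeAbelianVarieties ↔ (RankFourFaces.CMAbelianHodge ∧ CMFibreAlgebraicLift) :=
  ⟨fun h ↦ ⟨HC_CM_of_HC_AV h, cmFibreAlgebraicLift_of_HC_AV hSp h⟩,
    fun h ↦ HC_AV_of_HC_CM_and_cmFibreAlgebraicLift h₂₁ h.1 h.2⟩

/-- **EXACTNESS of (L∀): granted Lemme 6.3.1 and `SpreadCurve[]`, `HC_AV ⟺ HC_CM ∧ AlgebraicFixedPart`** (next to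
(L∀) the binder `HC_CM` is idle in PRINT — part I, KIND 1 — but the equivalence is the honest census statement).
[cite: Andre1996Motifs, Lemme 6.3.1 (p. 31) and Remarque 2 (p. 33)] [cite: Milne2020HodgeClassesAV, Prop. 1 (p. 7)] -/
theorem HC_AV_iff_HC_CM_and_algebraicFixedPart (h₂₁ : andre1996_cmAnchoredPencil) (hSp : SpreadCurve[]) :
    PadicSemiregularLift.HodgeAbelianVarieties ↔ (RankFourFaces.CMAbelianHodge ∧ AlgebraicFixedPart) :=
  ⟨fun h ↦ ⟨HC_CM_of_HC_AV h, algebraicFixedPart_of_HC_AV hSp h⟩,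
    fun h ↦ HC_AV_of_HC_CM_and_cmFibreAlgebraicLift h₂₁ h.1 (cmFibreAlgebraicLift_of_algebraicFixedPart h.2)⟩

/-- **The reduction item in lift form**: granted Lemme 6.3.1 and `SpreadCurve[]`,
`CMToAbelian ⟺ (HC_CM → CMFibreAlgebraicLift)` — item stmt-16267 is "under `HC_CM`, every invariant class of a
compact pencil of abelian varieties which is algebraic on a CM fibre is the restriction of an algebraic cycle of
the total space". Nothing closes the item. [cite: Andre1996Motifs, Remarque 2 (p. 33)] -/
theorem cmToAbelian_iff_HC_CM_imp_cmFibreAlgebraicLift (h₂₁ : andre1996_cmAnchoredPencil) (hSp : SpreadCurve[]) :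
    RankFourFaces.CMToAbelian ↔ (RankFourFaces.CMAbelianHodge → CMFibreAlgebraicLift) := by
  rw [cmToAbelian_iff_HC_CM_imp_cmAnchoredTransport h₂₁]
  exact ⟨fun h hCM ↦ cmFibreAlgebraicLift_of_cmAnchoredTransport hSp (h hCM),
    fun h hCM ↦ cmAnchoredTransport_of_cmFibreAlgebraicLift (h hCM)⟩

/-- **Under `HC_CM` (and Lemme 6.3.1, `SpreadCurve[]`) ALL FIVE André-axis nodes COINCIDE**: (2), (3), (4), (L),
(L∀) are then each equivalent to `HC_AV` (part I's `candidates_iff_of_HC_CM` for the transport nodes; §2 for the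
lifts). `HC_CM`, `h₂₁` BINDERS. [cite: Andre1996Motifs, Remarque 2 (p. 33)] -/
theorem liftCandidates_iff_of_HC_CM (h₂₁ : andre1996_cmAnchoredPencil) (hCM : RankFourFaces.CMAbelianHodge)
    (hSp : SpreadCurve[]) :
    (AlgebraicFixedPart ↔ CMAnchoredTransport) ∧ (CMFibreAlgebraicLift ↔ CMAnchoredTransport) ∧
      (CMPointedPencilVHC ↔ CMAnchoredTransport) ∧ (CompactAbelianPencilVHC ↔ CMAnchoredTransport) :=
  ⟨⟨fun h ↦ cmAnchoredTransport_of_cmFibreAlgebraicLift (cmFibreAlgebraicLift_of_algebraicFixedPart h),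
      fun h ↦ algebraicFixedPart_of_HC_AV hSp (HC_AV_of_HC_CM_and_Bmin h₂₁ hCM h)⟩,
    cmFibreAlgebraicLift_iff_cmAnchoredTransport hSp, (candidates_iff_of_HC_CM h₂₁ hCM).2,
    (candidates_iff_of_HC_CM h₂₁ hCM).1⟩

/-! ## §4 Graded: `HC` in dimension `d` alone gives the algebraic fixed part at relative dimension `d` -/

/-- **`HCAtDim d ∧ SpreadCurve[] ⟹` the body of (L∀) on every compact pencil of relative dimension `d`**: the
Hodge conjecture for the abelian FIBRES and the classical spreading produce the cycle on the `(d+1)`-dimensional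
total space — no Hodge/Lefschetz input on the total space is needed for the LIFT. (Compare part VI §F: total
spaces of dimension `≤ 3` by `HC` of the total space; part XVIII-i: `d ≤ 3` fact-free by hom ≡ num.)
[cite: CharlesSchnell2014Notes, Cor. 11.3.6 (p. 494)] [cite: VoisinHodgeII2003, §3.3.1 and proof of Thm. 10.19] -/
theorem algebraicFixedPart_body_of_hcAtDim (hSp : SpreadCurve[]) {d : ℕ} (h : HCAtDim d) {f : 𝒳 ⟶ S}
    (hf : IsCompactAbelianPencil f d) (p : ℕ) (W : complexBetti 𝒳 (2 * p))
    (hW : ∀ s : ComplexPoints S, IsRationalClass (complexBetti.map (fiberι f s) (2 * p) W) ∧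
      IsOfHodgeType d (fiberOver f s) (2 * p) p p (complexBetti.map (fiberι f s) (2 * p) W))
    (s₀ : ComplexPoints S) :
    ∃ η ∈ algebraicClasses 𝒳 p,
      complexBetti.map (fiberι f s₀) (2 * p) η = complexBetti.map (fiberι f s₀) (2 * p) W := by
  obtain ⟨η, hη, hηW⟩ := exists_algebraic_lift_of_hcAtDim hSp h hf W hW
  exact ⟨η, hη, hηW s₀⟩

/-- **Graded transport ⟹ graded lift at a CM-pointed pencil, granted `SpreadCurve[]`**: on a compact pencil of
relative dimension `d` with a CM point `t`, part IV's `CMAnchoredTransportAtRelDim d` and algebraicity at `t` give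
the lift at EVERY fibre. [cite: Andre1996Motifs, §6.3 a) (p. 33)] [cite: VoisinHodgeII2003, §3.3.1] -/
theorem exists_algebraic_lift_of_cmAnchoredTransportAtRelDim (hSp : SpreadCurve[]) {d : ℕ}
    (h : CMAnchoredTransportAtRelDim d) {f : 𝒳 ⟶ S} (hf : IsCompactAbelianPencil f d) (p : ℕ)
    (W : complexBetti 𝒳 (2 * p))
    (hW : ∀ s : ComplexPoints S, IsRationalClass (complexBetti.map (fiberι f s) (2 * p) W) ∧
      IsOfHodgeType d (fiberOver f s) (2 * p) p p (complexBetti.map (fiberι f s) (2 * p) W))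
    {t : ComplexPoints S} (ht : t ∈ cmLocus f d)
    (h₀ : complexBetti.map (fiberι f t) (2 * p) W ∈ algebraicClasses (fiberOver f t) p) :
    ∃ η ∈ algebraicClasses 𝒳 p, ∀ s : ComplexPoints S,
      complexBetti.map (fiberι f s) (2 * p) η = complexBetti.map (fiberι f s) (2 * p) W :=
  exists_algebraic_lift_of_forall_mem_algebraicClasses hSp hf W (fun s ↦ (hW s).1) (h f hf p W hW t ht h₀)

/-- **Relative dimension 4: the algebraic fixed part for compact pencils of abelian FOURFOLDS**, modulo
`SpreadCurve[]` and the tree's named facts Moonen–Zarhin 1999 Thm. 0.1 (codimension-2 Hodge classes on abelian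
fourfolds) and Markman 2025 (Weil classes on abelian fourfolds of Weil type are algebraic) — through
`ClassTargets.hcAtDim_four_of_weilClassesFourfolds`. In particular part XVIII-i's "smallest open instance of the
lift, `d = 4`, `(p,q) = (2,2)`" is settled MODULO these three inputs (two printed, one an arXiv claim); it stays the
smallest instance open fact-free in the kernel. [cite: MoonenZarhin1999LowDim, Thm. 0.1 with (1.4), (1.9)]
[cite: Markman2025SecantWeil, Cor. 1.6.1] [cite: VoisinHodgeII2003, §3.3.1 and proof of Thm. 10.19] -/
theorem algebraicFixedPart_body_of_relDim_four (hSp : SpreadCurve[])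
    (h01 : MoonenZarhin1999_codimTwoHodgeClasses_abelianFourfold)
    (hM : Markman2025_weilClasses_algebraic_abelianFourfold) {f : 𝒳 ⟶ S}
    (hf : IsCompactAbelianPencil f 4) (p : ℕ) (W : complexBetti 𝒳 (2 * p))
    (hW : ∀ s : ComplexPoints S, IsRationalClass (complexBetti.map (fiberι f s) (2 * p) W) ∧
      IsOfHodgeType 4 (fiberOver f s) (2 * p) p p (complexBetti.map (fiberι f s) (2 * p) W))
    (s₀ : ComplexPoints S) :
    ∃ η ∈ algebraicClasses 𝒳 p,
      complexBetti.map (fiberι f s₀) (2 * p) η = complexBetti.map (fiberι f s₀) (2 * p) W :=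
  algebraicFixedPart_body_of_hcAtDim hSp (hcAtDim_four_of_weilClassesFourfolds h01 hM) hf p W hW s₀

/-- **Relative dimension 5: the algebraic fixed part for compact pencils of abelian FIVEFOLDS**, modulo
`SpreadCurve[]`, Moonen–Zarhin 1999 Thms. 0.1–0.2 and Markman 2025 (through `ClassTargets.hcAtDim_five_of_hcAtDim_four`).
[cite: MoonenZarhin1999LowDim, Thm. 0.2 with (2.8), §5 (5.11)] [cite: Markman2025SecantWeil, Cor. 1.6.1]
[cite: VoisinHodgeII2003, §3.3.1 and proof of Thm. 10.19] -/
theorem algebraicFixedPart_body_of_relDim_five (hSp : SpreadCurve[])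
    (h01 : MoonenZarhin1999_codimTwoHodgeClasses_abelianFourfold)
    (h02 : MoonenZarhin1999_codimTwoHodgeClasses_abelianFivefold)
    (hM : Markman2025_weilClasses_algebraic_abelianFourfold) {f : 𝒳 ⟶ S}
    (hf : IsCompactAbelianPencil f 5) (p : ℕ) (W : complexBetti 𝒳 (2 * p))
    (hW : ∀ s : ComplexPoints S, IsRationalClass (complexBetti.map (fiberι f s) (2 * p) W) ∧
      IsOfHodgeType 5 (fiberOver f s) (2 * p) p p (complexBetti.map (fiberι f s) (2 * p) W))
    (s₀ : ComplexPoints S) :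
    ∃ η ∈ algebraicClasses 𝒳 p,
      complexBetti.map (fiberι f s₀) (2 * p) η = complexBetti.map (fiberι f s₀) (2 * p) W :=
  algebraicFixedPart_body_of_hcAtDim hSp
    (hcAtDim_five_of_hcAtDim_four h02 (hcAtDim_four_of_weilClassesFourfolds h01 hM)) hf p W hW s₀

end Summit.HodgeConjecture.HodgeConjecture.Ring2.AbelianAll

end
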